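/-
Copyright (c) 2026 the pub-hodgecm-mathlib formalisation cell (harness21).  Prover seat hodgecm-mathlib-K2Liu-p09 (g5): Track B «K2-LIT»,
hLiu418 = stmt-HodgeConjecture-24832; LEAD F0P6-plan (g12) RULING M-156m 2026-09-04T07:51:54Z «A7 = GK COCYCLE ROAD», file B5b.
-/
import Summits.HodgeConjecture.HodgeConjecture.Theorems.K2LiuRankOneLevelShells   -- B5a: shells, head sum, shell tails
import Summits.HodgeConjecture.HodgeConjecture.Theorems.K2LiuLocalLFactorDefs     -- ★ T1 `unramValue`, `lFactor`, `IsUnramifiedChar`, `unifAt`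
import HarnessLib

/-!
# Crux `HLiu418`, road `K2_Liu`, organ A7-reg (RULING M-156m, GK cocycle road), file B5b:
# THE RANK-ONE INTERTWINING INTEGRAL AT LEVEL `K′` — HEAD + TAIL, and ONE FORMULA at a completion `K_w`

Cell `hodgecm-mathlib`, crux item hLiu418 = `stmt-HodgeConjecture-24832`; squad K2 ∕ K2Liu; prover K2Liu-p09 (g5).
THEOREMS ONLY (no `def`, no instance, no notation, no named-fact hypothesis, no `sorry`); lane `--supports stmt-HodgeConjecture-24832`
(count-neutral helper).  On top of B5a ★ `K2LiuRankOneLevelShells` (generic local field `𝕜`, additive Haar `μ`; `g` locally constant modulo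
`𝔭^r` on the head ball `𝔭^n = ⨆_{y∈R}(y + 𝔭^r)`, equal to `C ν(x)⁻¹ ‖x‖^{−e}` off it, `ν` unitary, `re e > 1`):
* §4 HEAD + TAIL — UNRAMIFIED `ν`: `g ∈ L¹` and `∫ g = Σ_{y∈R} μ(𝔭^r) g(y) + C (1 − q⁻¹) μ(𝒪) · ρ^{1−n}/(1 − ρ)`, `ρ = ν(ϖ) q^{1−e}`;
  RAMIFIED `ν`: `∫ g = Σ_{y∈R} μ(𝔭^r) g(y)` (no `L`-factor: dead factor `1`);
* §5 at a completion `𝕜 = K_w` of a number field, the two cases in ONE formula through the dead-factor convention of ★ T1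
  `K2LiuLocalLFactorDefs` (`unramValue ν = 0` for ramified `ν`):
  **`∫ g = Σ_{y∈R} μ(𝔭^r) g(y) + C (1 − q⁻¹) μ(𝒪) · (unramValue ν · q^{1−e})^{m+1} · L(e − 1, ν)`** (`n = −m`).
Downstream (B6 `K2LiuRankOneFamilies`): with `R` fixed (independent of `s`) and `e = e(s)` affine in `s`, the right-hand side is a
`q^{-s}`-rational function of `s`, regular at `½`, as soon as the finitely many values `g_s(y)` are — the normalised rank-one operator
`L(e−1,ν)⁻¹ · A_α` preserves regularity at `½` (★ `K2LiuQRationalLFactor` supplies the regularity of `L(e(s) − 1, ν)` itself).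
HONEST LABEL.  `HC_CM` is proved only modulo the 7 printed citations (2 remaining named inputs: hLiu418 = `stmt-HodgeConjecture-24832`,
h413 = `stmt-HodgeConjecture-24833`) until rung 0 closes.

## References
* [Casselman1980] W. Casselman, *The unramified principal series of p-adic groups I*, Compositio Math. 40 (1980), §3 Thm. 3.1 (rank-one `c_α`).
* [Tate1950] J. Tate, *Fourier analysis in number fields and Hecke's zeta-functions* (1950), §2.4–2.5 (shell sums, vanishing of
  `∫_{𝒪ˣ} ν` for ramified `ν`).
* [KudlaSweet1997] S. Kudla, W. J. Sweet, Israel J. Math. 98 (1997), §1 (rationality of the intertwining operator in `q^{-s}`).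
-/

set_option autoImplicit false
set_option linter.dupNamespace false -- the mandated namespace repeats `HodgeConjecture.HodgeConjecture`

noncomputable section

open MeasureTheory Filter Topology Set
open scoped NNReal ENNReal
open Literature.NumberTheory.GaloisRepresentations.IsNonarchimedeanLocalField
open Literature.NumberTheory.Automorphic Literature.NumberTheory.Automorphic.LocalFieldHaar
open Summit.HodgeConjecture.HodgeConjecture.Cruxes.HLiu418.K2LiuGKRankOneIntegral (one_lt_residueFieldCard_real)
open Summit.HodgeConjecture.HodgeConjecture.Cruxes.HLiu418.K2LiuRankOneLevelShells

namespace Summit.HodgeConjecture.HodgeConjecture.Cruxes.HLiu418.K2LiuRankOneLevelHolomorphy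

variable {F : Type*} [Field F] [ValuativeRel F] [TopologicalSpace F] [IsNonarchimedeanLocalField F]
  [MeasurableSpace F] [BorelSpace F] {μ : Measure F} [μ.IsAddHaarMeasure]

/-! ## §4 HEAD + TAIL -/

omit [μ.IsAddHaarMeasure] in
/-- **A function constant on the cosets of `𝔭^m` is continuous, hence a.e.-strongly measurable** — the measurability input of
★ `integrableOn_and_hasSum_tail` for the rank-one integrands `x ↦ f(w u(x) y)` of a SMOOTH section `f` (right-invariant under an
open subgroup containing `u(𝔭^m)`). [cite: BushnellHenniart2006, §1.1] -/
theorem aestronglyMeasurable_of_forall_add_mem (g : F → ℂ) (m : ℤ) (hg : ∀ x : F, ∀ t ∈ primePowBall F m, g (x + t) = g x) :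
    AEStronglyMeasurable g μ := by
  have hcont : Continuous g := by
    refine continuous_iff_continuousAt.2 fun x => ?_
    have hopen : IsOpen {y : F | y - x ∈ primePowBall F m} :=
      (isOpen_primePowBall m).preimage (continuous_id.sub continuous_const)
    have hmem : x ∈ {y : F | y - x ∈ primePowBall F m} := by simp [zero_mem_primePowBall]
    refine (continuousAt_const : ContinuousAt (fun _ => g x) x).congr ?_
    filter_upwards [hopen.mem_nhds hmem] with y hy
    have h := hg x (y - x) hy
    rw [add_sub_cancel] at h
    exact h.symm
  exact hcont.aestronglyMeasurable


/-- **HEAD + TAIL, unramified character.**  `g` locally constant modulo `𝔭^r` on `𝔭^n = ⨆_{y∈R}(y + 𝔭^r)` and equal to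
`C ν(x)⁻¹ ‖x‖^{−e}` off `𝔭^n`, with `ν` unitary and UNRAMIFIED, `re e > 1`: `g ∈ L¹(μ)` and
`∫ g = Σ_{y∈R} μ(𝔭^r) g(y) + C (1 − q⁻¹) μ(𝒪) · ρ^{1−n}/(1 − ρ)`, `ρ = ν(ϖ) q^{1−e}` (`‖ρ‖ = q^{1 − re e} < 1`).
[cite: Casselman1980, §3 Thm. 3.1] [cite: Tate1950, §2.4–2.5] -/
theorem integrable_and_integral_eq_of_unramified {n r : ℤ} (R : Finset F)
    (hRinc : ∀ y ∈ R, ∀ y' ∈ R, y ≠ y' → y - y' ∉ primePowBall F r)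
    (hRcov : primePowBall F n = ⋃ y ∈ R, {x : F | x - y ∈ primePowBall F r})
    (g : F → ℂ) (hgm : AEStronglyMeasurable g μ) (hhead : ∀ y ∈ R, ∀ x : F, x - y ∈ primePowBall F r → g x = g y)
    (ν : Fˣ →* ℂˣ) (hν : ∀ u : Fˣ, ‖((ν u : ℂˣ) : ℂ)‖ = 1) (hun : ∀ u : Fˣ, normAbs F (u : F) = 1 → ν u = 1)
    (ϖ : Fˣ) (hϖ : normAbs F (ϖ : F) = (residueFieldCard F : ℝ≥0)⁻¹) (C e : ℂ) (he : 1 < e.re)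
    (htail : ∀ u : Fˣ, (u : F) ∉ primePowBall F n → g u = C * (((ν u)⁻¹ : ℂˣ) : ℂ) * ((normAbs F (u : F) : ℝ) : ℂ) ^ (-e)) :
    Integrable g μ ∧ ∫ x, g x ∂μ = (∑ y ∈ R, (μ.real (primePowBall F r) : ℂ) * g y) +
      C * (1 - (residueFieldCard F : ℂ)⁻¹) * μ.real (primePowBall F 0) *
        ((((ν ϖ : ℂˣ) : ℂ) * (residueFieldCard F : ℂ) ^ (1 - e)) ^ (1 - n) /
          (1 - ((ν ϖ : ℂˣ) : ℂ) * (residueFieldCard F : ℂ) ^ (1 - e))) := by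
  obtain ⟨hheadI, hheadV⟩ := integrableOn_and_setIntegral_head_eq_sum μ R hRinc hRcov g hhead
  obtain ⟨htailI, htailS⟩ := integrableOn_and_hasSum_tail n g hgm ν hν C e he htail
  set ρ : ℂ := ((ν ϖ : ℂˣ) : ℂ) * (residueFieldCard F : ℂ) ^ (1 - e) with hρ
  have hq0 : (residueFieldCard F : ℂ) ≠ 0 := by exact_mod_cast residueFieldCard_ne_zero F
  have hρnorm : ‖ρ‖ < 1 := by
    rw [hρ, norm_mul, hν, one_mul, Complex.norm_natCast_cpow_of_pos (Nat.pos_of_ne_zero (residueFieldCard_ne_zero F)),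
      Complex.sub_re, Complex.one_re]
    exact Real.rpow_lt_one_of_one_lt_of_neg one_lt_residueFieldCard_real (by linarith)
  have hρ0 : ρ ≠ 0 := by
    rw [hρ]
    exact mul_ne_zero (Units.ne_zero _) ((Complex.cpow_ne_zero_iff_of_exponent_ne_zero (by
      intro h; have := congrArg Complex.re h; simp at this; linarith)).2 hq0)
  have hint : Integrable g μ := by
    rw [← integrableOn_univ, ← Set.union_compl_self (primePowBall F n)]
    exact hheadI.union htailI
  refine ⟨hint, ?_⟩
  -- the tail, shell by shell
  have hshell : ∀ j : ℕ, ∫ x in primePowBall F (n - 1 - j) \ primePowBall F (n - 1 - j + 1), g x ∂μ =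
      C * (1 - (residueFieldCard F : ℂ)⁻¹) * μ.real (primePowBall F 0) * ρ ^ ((j : ℤ) + 1 - n) := fun j =>
    setIntegral_outerShell_of_unramified n j g ν hun ϖ hϖ C e htail
  have hgeom : HasSum (fun j : ℕ => C * (1 - (residueFieldCard F : ℂ)⁻¹) * μ.real (primePowBall F 0) * ρ ^ ((j : ℤ) + 1 - n))
      (C * (1 - (residueFieldCard F : ℂ)⁻¹) * μ.real (primePowBall F 0) * (ρ ^ (1 - n) / (1 - ρ))) := by
    have h := (hasSum_geometric_of_norm_lt_one hρnorm).mul_left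
      (C * (1 - (residueFieldCard F : ℂ)⁻¹) * μ.real (primePowBall F 0) * ρ ^ (1 - n))
    have hf : (fun j : ℕ => C * (1 - (residueFieldCard F : ℂ)⁻¹) * μ.real (primePowBall F 0) * ρ ^ ((j : ℤ) + 1 - n)) =
        fun j : ℕ => C * (1 - (residueFieldCard F : ℂ)⁻¹) * μ.real (primePowBall F 0) * ρ ^ (1 - n) * ρ ^ j := by
      funext j
      rw [show ((j : ℤ) + 1 - n) = (1 - n) + (j : ℤ) by ring, zpow_add₀ hρ0, zpow_natCast]
      ring
    have hv : C * (1 - (residueFieldCard F : ℂ)⁻¹) * μ.real (primePowBall F 0) * (ρ ^ (1 - n) / (1 - ρ)) =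
        C * (1 - (residueFieldCard F : ℂ)⁻¹) * μ.real (primePowBall F 0) * ρ ^ (1 - n) * (1 - ρ)⁻¹ := by
      rw [div_eq_mul_inv]
      ring
    rw [hf, hv]
    exact h
  have htailV : ∫ x in (primePowBall F n)ᶜ, g x ∂μ =
      C * (1 - (residueFieldCard F : ℂ)⁻¹) * μ.real (primePowBall F 0) * (ρ ^ (1 - n) / (1 - ρ)) := by
    refine htailS.unique ?_
    simp_rw [hshell]
    exact hgeom
  rw [← integral_add_compl (measurableSet_primePowBall n) hint, hheadV, htailV]

/-- **HEAD + TAIL, ramified character: the tail is `0`.**  Same setting with `ν(u₀) ≠ 1` for some unit `u₀`: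
`∫ g = Σ_{y∈R} μ(𝔭^r) g(y)` — the rank-one operator of a ramified datum has NO `L`-factor (dead factor `1`).
[cite: Tate1950, §2.5] [cite: KudlaSweet1997, §1] -/
theorem integrable_and_integral_eq_of_ramified {n r : ℤ} (R : Finset F)
    (hRinc : ∀ y ∈ R, ∀ y' ∈ R, y ≠ y' → y - y' ∉ primePowBall F r)
    (hRcov : primePowBall F n = ⋃ y ∈ R, {x : F | x - y ∈ primePowBall F r})
    (g : F → ℂ) (hgm : AEStronglyMeasurable g μ) (hhead : ∀ y ∈ R, ∀ x : F, x - y ∈ primePowBall F r → g x = g y)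
    (ν : Fˣ →* ℂˣ) (hν : ∀ u : Fˣ, ‖((ν u : ℂˣ) : ℂ)‖ = 1) (hram : ∃ u₀ : Fˣ, normAbs F (u₀ : F) = 1 ∧ ν u₀ ≠ 1)
    (C e : ℂ) (he : 1 < e.re)
    (htail : ∀ u : Fˣ, (u : F) ∉ primePowBall F n → g u = C * (((ν u)⁻¹ : ℂˣ) : ℂ) * ((normAbs F (u : F) : ℝ) : ℂ) ^ (-e)) :
    Integrable g μ ∧ ∫ x, g x ∂μ = ∑ y ∈ R, (μ.real (primePowBall F r) : ℂ) * g y := by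
  obtain ⟨hheadI, hheadV⟩ := integrableOn_and_setIntegral_head_eq_sum μ R hRinc hRcov g hhead
  obtain ⟨htailI, htailS⟩ := integrableOn_and_hasSum_tail n g hgm ν hν C e he htail
  have hint : Integrable g μ := by
    rw [← integrableOn_univ, ← Set.union_compl_self (primePowBall F n)]
    exact hheadI.union htailI
  refine ⟨hint, ?_⟩
  have htailV : ∫ x in (primePowBall F n)ᶜ, g x ∂μ = 0 := by
    refine htailS.unique ?_
    simp_rw [setIntegral_outerShell_of_ramified n _ g ν hram C e htail]
    exact hasSum_zero
  rw [← integral_add_compl (measurableSet_primePowBall n) hint, hheadV, htailV, add_zero]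

end Summit.HodgeConjecture.HodgeConjecture.Cruxes.HLiu418.K2LiuRankOneLevelHolomorphy

/-! ## §5 At a completion `K_w`: the two cases in one formula through ★ T1's dead-factor convention -/

namespace Summit.HodgeConjecture.HodgeConjecture.Cruxes.HLiu418.K2LiuRankOneLevelHolomorphy

open NumberField IsDedekindDomain
open Summit.HodgeConjecture.HodgeConjecture.Cruxes.HLiu418.K2LiuLocalLFactorDefs

variable {K : Type} [Field K] [NumberField K] {w : HeightOneSpectrum (𝓞 K)}

/-- on `K_w`, `‖x‖ = 1` iff the (adic) valuation of `x` is `1` (★ `normAbs` is built on the `ValuativeRel` valuation, which is equivalent to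
`Valued.v`). [folklore] -/
theorem normAbs_eq_one_iff_valued_eq_one (x : w.adicCompletion K) : normAbs (w.adicCompletion K) x = 1 ↔ Valued.v x = 1 := by
  have hequiv := (ValuativeRel.isEquiv (ValuativeRel.valuation (w.adicCompletion K)) (Valued.v : Valuation (w.adicCompletion K) _))
  rw [← hequiv.eq_one_iff_eq_one]
  constructor
  · intro h
    have h1 : normAbs (w.adicCompletion K) x ≤ 1 := h.le
    have h2 : ¬ normAbs (w.adicCompletion K) x < 1 := by rw [h]; exact lt_irrefl 1
    rw [normAbs_le_one_iff, Valuation.mem_integer_iff] at h1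
    rw [normAbs_lt_one_iff] at h2
    exact le_antisymm h1 (not_lt.1 h2)
  · intro h
    apply le_antisymm
    · rw [normAbs_le_one_iff, Valuation.mem_integer_iff]; exact h.le
    · by_contra hlt
      rw [not_le, normAbs_lt_one_iff, h] at hlt
      exact lt_irrefl 1 hlt

/-- ★ T1's `IsUnramifiedChar` in terms of `‖·‖`. [cite: Tate1950, §2.5] -/
theorem isUnramifiedChar_iff_normAbs (ν : (w.adicCompletion K)ˣ →* ℂˣ) :
    IsUnramifiedChar ν ↔ ∀ u : (w.adicCompletion K)ˣ, normAbs (w.adicCompletion K) (u : w.adicCompletion K) = 1 → ν u = 1 := by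
  simp only [IsUnramifiedChar, normAbs_eq_one_iff_valued_eq_one]

/-- the chosen uniformizer `ϖ_w` of ★ T1 has `‖ϖ_w‖ = q_w⁻¹`. [cite: Tate1950, §2.5] -/
theorem normAbs_unifAt : normAbs (w.adicCompletion K) (unifAt K w) = (residueFieldCard (w.adicCompletion K) : ℝ≥0)⁻¹ :=
  normAbs_eq_inv_of_valued_eq_exp_neg_one w (valued_unifAt K w)

/-- **THE RANK-ONE LEVEL-`K′` INTEGRAL AT A COMPLETION `K_w`, ONE FORMULA FOR BOTH CASES.**  For `g : K_w → ℂ` locally constant modulo `𝔭^r`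
on the head ball `𝔭^{−m} = ⨆_{y∈R}(y + 𝔭^r)` and equal to `C ν(x)⁻¹ ‖x‖^{−e}` off it (`ν` unitary, `re e > 1`):
`∫ g = Σ_{y∈R} μ(𝔭^r) g(y) + C (1 − q⁻¹) μ(𝒪) · (unramValue ν · q^{1−e})^{m+1} · L(e − 1, ν)`
(★ T1 `unramValue`, `lFactor`; for ramified `ν` the last term is `0` — dead factor — and indeed the tail vanishes).
[cite: Casselman1980, §3 Thm. 3.1] [cite: Tate1950, §2.4–2.5] [cite: KudlaSweet1997, §1] -/
theorem integrable_and_integral_eq [MeasurableSpace (w.adicCompletion K)] [BorelSpace (w.adicCompletion K)]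
    (μ : Measure (w.adicCompletion K)) [μ.IsAddHaarMeasure] (m : ℕ) {r : ℤ} (R : Finset (w.adicCompletion K))
    (hRinc : ∀ y ∈ R, ∀ y' ∈ R, y ≠ y' → y - y' ∉ primePowBall (w.adicCompletion K) r)
    (hRcov : primePowBall (w.adicCompletion K) (-(m : ℤ)) = ⋃ y ∈ R, {x | x - y ∈ primePowBall (w.adicCompletion K) r})
    (g : w.adicCompletion K → ℂ) (hgm : AEStronglyMeasurable g μ)
    (hhead : ∀ y ∈ R, ∀ x, x - y ∈ primePowBall (w.adicCompletion K) r → g x = g y)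
    (ν : (w.adicCompletion K)ˣ →* ℂˣ) (hν : ∀ u, ‖((ν u : ℂˣ) : ℂ)‖ = 1) (C e : ℂ) (he : 1 < e.re)
    (htail : ∀ u : (w.adicCompletion K)ˣ, (u : w.adicCompletion K) ∉ primePowBall (w.adicCompletion K) (-(m : ℤ)) →
      g u = C * (((ν u)⁻¹ : ℂˣ) : ℂ) * ((normAbs (w.adicCompletion K) (u : w.adicCompletion K) : ℝ) : ℂ) ^ (-e)) :
    Integrable g μ ∧ ∫ x, g x ∂μ = (∑ y ∈ R, (μ.real (primePowBall (w.adicCompletion K) r) : ℂ) * g y) +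
      C * (1 - (residueFieldCard (w.adicCompletion K) : ℂ)⁻¹) * μ.real (primePowBall (w.adicCompletion K) 0) *
        ((unramValue K w ν * (residueFieldCard (w.adicCompletion K) : ℂ) ^ (1 - e)) ^ (m + 1) * lFactor K w ν (e - 1)) := by
  classical
  have hq0 : (residueFieldCard (w.adicCompletion K) : ℂ) ≠ 0 := by exact_mod_cast residueFieldCard_ne_zero (w.adicCompletion K)
  by_cases hun : IsUnramifiedChar ν
  · -- unramified: geometric tail
    have hun' := (isUnramifiedChar_iff_normAbs ν).1 hun
    obtain ⟨hint, hval⟩ := integrable_and_integral_eq_of_unramified (μ := μ) R hRinc hRcov g hgm hhead ν hν hun' (unifAtUnit K w)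
      (by rw [coe_unifAtUnit]; exact normAbs_unifAt) C e he htail
    refine ⟨hint, ?_⟩
    rw [hval]
    congr 1
    have hυ : unramValue K w ν = ((ν (unifAtUnit K w) : ℂˣ) : ℂ) := by rw [unramValue, if_pos hun]
    rw [hυ, lFactor_def, hυ, show (1 : ℤ) - -(m : ℤ) = ((m + 1 : ℕ) : ℤ) by push_cast; ring, zpow_natCast,
      show -(e - 1) = 1 - e by ring, div_eq_mul_inv]
  · -- ramified: the tail vanishes and the dead factor kills the formula's last term
    have hram : ∃ u₀ : (w.adicCompletion K)ˣ, normAbs (w.adicCompletion K) (u₀ : w.adicCompletion K) = 1 ∧ ν u₀ ≠ 1 := by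
      by_contra h
      push Not at h
      exact hun ((isUnramifiedChar_iff_normAbs ν).2 h)
    obtain ⟨hint, hval⟩ := integrable_and_integral_eq_of_ramified (μ := μ) R hRinc hRcov g hgm hhead ν hν hram C e he htail
    refine ⟨hint, ?_⟩
    rw [hval, unramValue_of_not K w hun, zero_mul, zero_pow (Nat.succ_ne_zero m), zero_mul, mul_zero, add_zero]

end Summit.HodgeConjecture.HodgeConjecture.Cruxes.HLiu418.K2LiuRankOneLevelHolomorphy

end
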